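import Literature.AlgebraicGeometry.Motives.AbelianVarietyHopf
import Mathlib.NumberTheory.Bernoulli
import HarnessLib

/-!
# Weights on the cohomology of an abelian variety: `n_A^* = nᵈ` on `Hᵈ(A)`

For a Weil cohomology theory `W` (Kleiman, *Algebraic cycles and the Weil conjectures* (1968),
§1.2) and an abelian variety `A` over `k`, smooth projective of dimension `g`, write
`[n] = 𝟙^n ∈ A(A)` for multiplication by `n` (the `n`-th power of the identity in the group of
`A`-valued points, Mathlib's `Hom.monoid`) and `[n]*` for the induced endomorphism of `Hᵈ(A)`.
Using the coproduct `Δ_{a,b}` of `Motives/AbelianVarietyHopf` we prove, formally in the axioms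
of `WeilCohomology`:

* the convolution recursion `[n+1]* x = [n]* x + x + Σ_{a,b≥1} [n]* x₍ₐ₎ ∪ x₍ᵦ₎`
  (`pullback_pow_succ`), `[n]* = n` on `H¹` (`pullback_pow_deg_one`);
* **no primitive classes in degree two** (`eq_zero_of_coprod_one_one_eq_zero`: an even primitive
  class `z` of a finite-dimensional connected bialgebra in characteristic `0` vanishes, via the
  contraction identity `D_ψ(zᵐ⁺¹) = (m+1) ψ(z) zᵐ`), hence `H²(A) = H¹(A) · H¹(A)`
  (`eq_half_mulOneOne_coprod`, cocommutativity) and `[n]* = n²` on `H²`, `[n]* = n^{2g}` on `H²ᵍ`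
  (given a degree-two class with nonzero `g`-th power, e.g. a hyperplane class);
* **polynomiality**: `[n]* = Σ_{i≤d} nⁱ Fᵢ` on `Hᵈ(A)` with operator coefficients
  (`exists_pullback_pow_eq_sum`, Faulhaber);
* **purity**: `[n]* = nᵈ` on `Hᵈ(A)` (`pullback_pow_eq_pow_smul`; Poincaré duality and a
  comparison of coefficients), the theorem `n_A* = nⁱ on Hⁱ(A)` of the classical theories
  (Mumford, *Abelian Varieties* §15; Kleiman 1968, Appendix 2A, for any Weil cohomology);
* **generation**: the cup product `H¹(A) ⊗ Hᵉ(A) → Hᵉ⁺¹(A)` is onto (`range_mulOne`), i.e.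
  `H•(A)` is generated by `H¹(A)` (Kleiman 1968, 2A: `H•(A) = Λ• H¹(A)`).

These are the inputs for the Lieberman–Kleiman theorem `B(A)` (standard conjecture of
Lefschetz type for abelian varieties). No named facts are introduced.

## References

* S. Kleiman, *Algebraic cycles and the Weil conjectures*, in: Dix exposés sur la cohomologie
  des schémas, North-Holland (1968), 359–386, Appendix 2A. [Kleiman1968AlgebraicCycles]
* D. Mumford, *Abelian Varieties*, TIFR Studies in Math. 5, OUP (1970), §1, §15. [MumfordAV1970]
-/

universe u v

open CategoryTheory AlgebraicGeometry MonoidalCategory CartesianMonoidalCategory Opposite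
open scoped TensorProduct DirectSum

noncomputable section

namespace Literature.AlgebraicGeometry.Motives

namespace WeilCohomology

variable {k : Type u} [Field k] {K : Type v} [Field K] [CharZero K] (W : WeilCohomology k K)

/-! ## The operators `n_A^*` (pull-back along multiplication by `n`) -/

section MulN

open scoped MonObj

variable {g : ℕ} (A : AbelianVariety k)

/-- The middle part of the convolution formula for `((𝟙)^n · 𝟙)*`: the sum over the bidegrees
`(a, b)` with `a, b ≠ 0` of `(𝟙^n)* x₍ₐ₎ ∪ x₍ᵦ₎`. [folklore] -/
def middleSum (hA : IsSmoothProjective g A.X) (n : ℕ) {d : ℕ} (x : W.obj A.X d) : W.obj A.X d :=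
  ∑ ij ∈ (Finset.univ : Finset ↥(Finset.antidiagonal d)).filter
      (fun ij ↦ ij.1.1 ≠ 0 ∧ ij.1.2 ≠ 0),
    W.mulPullback A ((𝟙 A.X) ^ n) (𝟙 A.X) (Finset.mem_antidiagonal.mp ij.2)
      (W.coprod A hA ij.1.1 ij.1.2 (Finset.mem_antidiagonal.mp ij.2) x)

/-- `[0]* = 0` in positive degrees (`[0]` is the neutral point). [folklore] -/
theorem pullback_pow_zero_eq_zero {d : ℕ} (hd : d ≠ 0) (x : W.obj A.X d) :
    W.pullback ((𝟙 A.X) ^ 0) d x = 0 := by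
  rw [pow_zero, W.pullback_one_eq_zero A hd]

/-- `[n]* 1 = 1`. [folklore] -/
theorem pullback_pow_unit (hA : IsSmoothProjective g A.X) (n : ℕ) :
    W.pullback ((𝟙 A.X) ^ n) 0 (W.one A.X) = W.one A.X :=
  W.map_one hA hA _

/-- `[n]*` is the identity on `H⁰(A) = K · 1`. [folklore] -/
theorem pullback_pow_deg_zero (hA : IsSmoothProjective g A.X) (n : ℕ) (x : W.obj A.X 0) :
    W.pullback ((𝟙 A.X) ^ n) 0 x = x := by
  obtain ⟨c, rfl⟩ := W.exists_eq_smul_one hA x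
  rw [map_smul, W.pullback_pow_unit A hA]

/-- `[n]*` is multiplicative: `[n]* (a ∪ b) = [n]* a ∪ [n]* b`. [folklore] -/
theorem pullback_pow_cup (hA : IsSmoothProjective g A.X) (n : ℕ) {i j l : ℕ} (h : i + j = l)
    (a : W.obj A.X i) (b : W.obj A.X j) :
    W.pullback ((𝟙 A.X) ^ n) l (W.cup h a b) =
      W.cup h (W.pullback ((𝟙 A.X) ^ n) i a) (W.pullback ((𝟙 A.X) ^ n) j b) :=
  W.map_cup hA hA _ h a b

/-- `[m n]* = [m]* ∘ [n]*` (as `[m n] = [n] ∘ [m]`, i.e. `𝟙^(m n) = 𝟙^m ≫ 𝟙^n` in `A(A)`).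
[folklore] -/
theorem pullback_pow_mul (m n d : ℕ) :
    W.pullback ((𝟙 A.X) ^ (m * n)) d =
      W.pullback ((𝟙 A.X) ^ m) d ∘ₗ W.pullback ((𝟙 A.X) ^ n) d := by
  rw [← W.pullback_comp, MonObj.comp_pow, Category.comp_id, pow_mul]

/-- **The convolution recursion** for `x ∈ Hᵈ(A)`, `d ≠ 0`:
`[n+1]* x = [n]* x + x + Σ_{a,b≠0, a+b=d} [n]* x₍ₐ₎ ∪ x₍ᵦ₎`, from `𝟙^(n+1) = 𝟙^n · 𝟙` in the
group `A(A)` of `A`-valued points, `pullback_mul`, and the counit (Mumford §1, proof that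
`H•(A)` is a Hopf algebra; Kleiman 1968 2A). [cite: MumfordAV1970, §1] -/
theorem pullback_pow_succ (hA : IsSmoothProjective g A.X) (n : ℕ) {d : ℕ} (hd : d ≠ 0)
    (x : W.obj A.X d) :
    W.pullback ((𝟙 A.X) ^ (n + 1)) d x =
      W.pullback ((𝟙 A.X) ^ n) d x + x + W.middleSum A hA n x := by
  classical
  rw [pow_succ, W.pullback_mul A hA hA _ _ x, middleSum,
    ← Finset.sum_filter_add_sum_filter_not Finset.univ
      (fun ij : ↥(Finset.antidiagonal d) ↦ ij.1.1 ≠ 0 ∧ ij.1.2 ≠ 0), add_comm]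
  congr 1
  have hne : kIdx (Nat.add_zero d) ≠ kIdx (Nat.zero_add d) := by
    intro e
    have := congrArg (fun ij ↦ ij.1.1) e
    simp at this
    exact hd this
  rw [Finset.sum_eq_add (kIdx (Nat.add_zero d)) (kIdx (Nat.zero_add d)) hne]
  · change W.mulPullback A _ _ (Nat.add_zero d) (W.coprod A hA d 0 (Nat.add_zero d) x) +
        W.mulPullback A _ _ (Nat.zero_add d) (W.coprod A hA 0 d (Nat.zero_add d) x) = _
    rw [W.coprod_self_zero A hA, W.coprod_zero_self A hA, mulPullback_tmul, mulPullback_tmul,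
      W.pullback_id, W.pullback_id, LinearMap.id_apply, LinearMap.id_apply, W.cup_one hA,
      W.pullback_pow_unit A hA, W.one_cup hA]
  · intro ij hij h2
    exfalso
    have h1 := Finset.mem_antidiagonal.mp ij.2
    rw [Finset.mem_filter] at hij
    rcases not_and_or.mp hij.2 with h3 | h3 <;> rw [not_ne_iff] at h3
    · exact h2.2 (Subtype.ext (Prod.ext h3 (by simp; omega)))
    · exact h2.1 (Subtype.ext (Prod.ext (by simp; omega) h3))
  · intro h
    exfalso
    exact h (Finset.mem_filter.mpr ⟨Finset.mem_univ _, by simp⟩)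
  · intro h
    exfalso
    exact h (Finset.mem_filter.mpr ⟨Finset.mem_univ _, by simp⟩)

/-- In degree one the middle sum is empty. [folklore] -/
lemma middleSum_deg_one (hA : IsSmoothProjective g A.X) (n : ℕ) (v : W.obj A.X 1) :
    W.middleSum A hA n v = 0 := by
  apply Finset.sum_eq_zero
  intro ij hij
  exfalso
  have h1 := Finset.mem_antidiagonal.mp ij.2
  rw [Finset.mem_filter] at hij
  omega

/-- **`[n]* = n` on `H¹(A)`** (degree-one classes are primitive). [cite: MumfordAV1970, §15] -/
theorem pullback_pow_deg_one (hA : IsSmoothProjective g A.X) (n : ℕ) (v : W.obj A.X 1) :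
    W.pullback ((𝟙 A.X) ^ n) 1 v = (n : K) • v := by
  induction n with
  | zero => rw [W.pullback_pow_zero_eq_zero A one_ne_zero, Nat.cast_zero, zero_smul]
  | succ n ih =>
    rw [W.pullback_pow_succ A hA n one_ne_zero, ih, W.middleSum_deg_one A hA, add_zero,
      Nat.cast_succ, add_smul, one_smul]

end MulN

/-! ## Degree two: no primitive classes, `H²(A) = H¹(A) · H¹(A)` -/

section DegreeTwo

open scoped MonObj

variable {g : ℕ} (A : AbelianVariety k)

/-- The **degree-two contraction** `D_ψ = (ψ ⊗ id) ∘ Δ_{2,c} : Hᵈ(A) → Hᶜ(A)` (`2 + c = d`)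
against a linear form `ψ` on `H²(A)`. [folklore] -/
def contrTwo (hA : IsSmoothProjective g A.X) (ψ : Module.Dual K (W.obj A.X 2)) {c d : ℕ}
    (h : 2 + c = d) : W.obj A.X d →ₗ[K] W.obj A.X c :=
  (TensorProduct.lid K (W.obj A.X c)).toLinearMap ∘ₗ LinearMap.rTensor (W.obj A.X c) ψ ∘ₗ
    W.coprod A hA 2 c h

/-- `D_ψ` on a class whose `(2, c)` coproduct component is known. [folklore] -/
lemma contrTwo_apply (hA : IsSmoothProjective g A.X) (ψ : Module.Dual K (W.obj A.X 2)) {c d : ℕ}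
    (h : 2 + c = d) (x : W.obj A.X d) :
    W.contrTwo A hA ψ h x =
      TensorProduct.lid K (W.obj A.X c) (LinearMap.rTensor (W.obj A.X c) ψ (W.coprod A hA 2 c h x)) :=
  rfl

/-- **Leibniz rule for a primitive degree-two class, low degrees**: if `m* z = pr₁* z + pr₂* z`
then for `x ∈ Hᶜ(A)` with `c < 2`, `Δ_{2,c}(x ∪ z) = z ⊗ x`. [folklore] -/
lemma coprod_two_cup_of_primitive_of_lt (hA : IsSmoothProjective g A.X) {z : W.obj A.X 2}
    (hz : W.pullback μ[A.X] 2 z = W.pullback (fst A.X A.X) 2 z + W.pullback (snd A.X A.X) 2 z)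
    {c d : ℕ} (hc : c < 2) (h : c + 2 = d) (h' : 2 + c = d) (x : W.obj A.X c) :
    W.coprod A hA 2 c h' (W.cup h x z) = z ⊗ₜ x := by
  have hAA := IsSmoothProjective.tensor_holds hA hA
  rw [coprod_apply, W.map_cup hAA hA μ[A.X] h x z, hz, LinearMap.map_add, map_add,
    W.kunnethComponent_cup_pullback_fst hA hA h _ z (Nat.zero_add c) (Nat.zero_add 2) h',
    W.kunnethComponent_cup_pullback_snd_eq_zero hA hA h _ z h' hc, add_zero, ← coprod_apply,
    W.coprod_zero_self A hA x, LinearMap.rTensor_tmul, LinearMap.flip_apply, W.one_cup hA,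
    negOnePow_mul_eq_one (Or.inr (by decide)), Units.val_one, one_smul]

/-- **Leibniz rule for a primitive degree-two class**: if `m* z = pr₁* z + pr₂* z` then for
`x ∈ Hᶜ⁺²(A)`, `Δ_{2,c+2}(x ∪ z) = z ⊗ x + (id ⊗ (· ∪ z)) Δ_{2,c}(x)`. [folklore] -/
lemma coprod_two_cup_of_primitive (hA : IsSmoothProjective g A.X) {z : W.obj A.X 2}
    (hz : W.pullback μ[A.X] 2 z = W.pullback (fst A.X A.X) 2 z + W.pullback (snd A.X A.X) 2 z)
    {c d e : ℕ} (hd : 2 + c = d) (hcd : c + 2 = d) (h : d + 2 = e) (h' : 2 + d = e)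
    (x : W.obj A.X d) :
    W.coprod A hA 2 d h' (W.cup h x z) =
      z ⊗ₜ x + LinearMap.lTensor (W.obj A.X 2) ((W.cup hcd).flip z) (W.coprod A hA 2 c hd x) := by
  have hAA := IsSmoothProjective.tensor_holds hA hA
  rw [coprod_apply, W.map_cup hAA hA μ[A.X] h x z, hz, LinearMap.map_add, map_add,
    W.kunnethComponent_cup_pullback_fst hA hA h _ z (Nat.zero_add d) (Nat.zero_add 2) h',
    W.kunnethComponent_cup_pullback_snd hA hA h _ z hd hcd h', ← coprod_apply, ← coprod_apply,
    W.coprod_zero_self A hA x, LinearMap.rTensor_tmul, LinearMap.flip_apply, W.one_cup hA,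
    negOnePow_mul_eq_one (Or.inr (by decide)), Units.val_one, one_smul]

/-- **`D_ψ(zᵐ⁺¹) = (m + 1) ψ(z) zᵐ`** for a primitive degree-two class `z` (the Leibniz rule
iterated; `D_ψ z = ψ(z) · 1`). [folklore] -/
lemma contrTwo_pow_of_primitive (hA : IsSmoothProjective g A.X) (ψ : Module.Dual K (W.obj A.X 2))
    {z : W.obj A.X 2}
    (hz : W.pullback μ[A.X] 2 z = W.pullback (fst A.X A.X) 2 z + W.pullback (snd A.X A.X) 2 z)
    (m : ℕ) (h : 2 + 2 * m = 2 * (m + 1)) :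
    W.contrTwo A hA ψ h (W.pow A.X z (m + 1)) = ((m + 1 : ℕ) : K) • ψ z • W.pow A.X z m := by
  induction m with
  | zero =>
    rw [contrTwo_apply, W.pow_succ, W.pow_zero,
      W.coprod_two_cup_of_primitive_of_lt A hA hz (by omega) rfl h (W.one A.X)]
    simp
  | succ m ih =>
    rw [contrTwo_apply, W.pow_succ A.X z (m + 1),
      W.coprod_two_cup_of_primitive A hA hz (show 2 + 2 * m = 2 * (m + 1) by omega)
        (show 2 * m + 2 = 2 * (m + 1) by omega) rfl h,
      map_add, map_add, LinearMap.rTensor_tmul, TensorProduct.lid_tmul]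
    have ih' := ih (by omega)
    rw [contrTwo_apply] at ih'
    -- second term: `(ψ ⊗ id)` commutes with `id ⊗ (· ∪ z)`
    have hcomm : TensorProduct.lid K _ (LinearMap.rTensor (W.obj A.X (2 * (m + 1))) ψ
        (LinearMap.lTensor (W.obj A.X 2)
          ((W.cup (show 2 * m + 2 = 2 * (m + 1) by omega)).flip z)
          (W.coprod A hA 2 (2 * m) (by omega) (W.pow A.X z (m + 1))))) =
        W.cup (show 2 * m + 2 = 2 * (m + 1) by omega)
          (TensorProduct.lid K _ (LinearMap.rTensor (W.obj A.X (2 * m)) ψ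
          (W.coprod A hA 2 (2 * m) (by omega) (W.pow A.X z (m + 1))))) z := by
      generalize W.coprod A hA 2 (2 * m) _ (W.pow A.X z (m + 1)) = t
      induction t using TensorProduct.induction_on with
      | zero => simp
      | tmul a b => simp
      | add t t' ht ht' =>
        simp only [map_add, ht, ht', LinearMap.add_apply]
    rw [hcomm, ih', LinearMap.map_smul₂, LinearMap.map_smul₂, ← W.pow_succ, smul_smul, smul_smul,
      ← add_smul]
    congr 1
    push_cast
    ring

omit [CharZero K] in
/-- A linear form taking the value `1` on a given nonzero vector. [folklore] -/
lemma exists_dual_eq_one {V : Type*} [AddCommGroup V] [Module K V] {v : V} (hv : v ≠ 0) :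
    ∃ ψ : Module.Dual K V, ψ v = 1 := by
  obtain ⟨φ, hφ⟩ := not_forall.mp (mt (Module.forall_dual_apply_eq_zero_iff K v).mp hv)
  exact ⟨(φ v)⁻¹ • φ, by simp [inv_mul_cancel₀ hφ]⟩

/-- **No primitive classes in degree two**: a class `z ∈ H²(A)` with `Δ_{1,1} z = 0` vanishes.
Indeed `z` is then primitive, `zᵍ⁺¹ = 0` (degree `> 2g`), and if `zᵐ⁺¹ = 0` then
`0 = D_ψ(zᵐ⁺¹) = (m+1) ψ(z) zᵐ` with `ψ(z) = 1` gives `zᵐ = 0`; descending, `z⁰ = 1 = 0`,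
absurd (Milnor–Moore / Hopf: even-degree primitives of a finite-dimensional connected Hopf algebra in
characteristic zero vanish; Mumford §1). [cite: MumfordAV1970, §1] -/
theorem eq_zero_of_coprod_one_one_eq_zero (hA : IsSmoothProjective g A.X) {z : W.obj A.X 2}
    (hz : W.coprod A hA 1 1 rfl z = 0) : z = 0 := by
  by_contra hz0
  have hprim : W.pullback μ[A.X] 2 z =
      W.pullback (fst A.X A.X) 2 z + W.pullback (snd A.X A.X) 2 z := by
    refine W.pullback_mu_eq_of_coprod_eq_zero A hA two_ne_zero z fun a b h ha hb ↦ ?_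
    obtain rfl : a = 1 := by omega
    obtain rfl : b = 1 := by omega
    exact hz
  obtain ⟨ψ, hψ⟩ := exists_dual_eq_one (K := K) hz0
  -- all powers vanish, by descending induction from `g + 1`
  have hpow : ∀ m, W.pow A.X z m = 0 := by
    suffices H : ∀ j m, m + j = g + 1 → W.pow A.X z m = 0 from fun m ↦ by
      by_cases hm : m ≤ g + 1
      · exact H (g + 1 - m) m (by omega)
      · have e : m = (g + 1) + (m - (g + 1)) := by omega
        rw [e]
        generalize m - (g + 1) = j
        induction j with
        | zero => exact H 0 _ rfl
        | succ j ih => rw [← add_assoc, W.pow_succ, ih, LinearMap.map_zero₂]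
    intro j
    induction j with
    | zero =>
      intro m hm
      rw [add_zero] at hm
      subst hm
      exact W.eq_zero_of_lt hA (by omega) _
    | succ j ih =>
      intro m hm
      have h1 := ih (m + 1) (by omega)
      have h2 := W.contrTwo_pow_of_primitive A hA ψ hprim m (by omega)
      rw [h1, map_zero, hψ, one_smul] at h2
      exact (smul_eq_zero.mp h2.symm).resolve_left (by exact_mod_cast Nat.succ_ne_zero m)
  exact W.unit_ne_zero hA (by simpa using hpow 0)

/-- The cup product `H¹(A) ⊗ H¹(A) → H²(A)` on tensors. [folklore] -/
def mulOneOne : W.obj A.X 1 ⊗[K] W.obj A.X 1 →ₗ[K] W.obj A.X 2 :=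
  TensorProduct.lift (W.cup (rfl : 1 + 1 = 2))

/-- `mulOneOne` on an elementary tensor is the cup product. [folklore] -/
@[simp]
lemma mulOneOne_tmul (v w : W.obj A.X 1) :
    W.mulOneOne A (v ⊗ₜ w) = W.cup (rfl : 1 + 1 = 2) v w := by
  simp [mulOneOne]

/-- `Δ_{1,1} ∘ mul = id - σ` on `H¹ ⊗ H¹` (from `Δ_{1,1}(v ∪ w) = v ⊗ w - w ⊗ v`). [folklore] -/
lemma coprod_one_one_mulOneOne (hA : IsSmoothProjective g A.X) (t : W.obj A.X 1 ⊗[K] W.obj A.X 1) :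
    W.coprod A hA 1 1 rfl (W.mulOneOne A t) = t - TensorProduct.comm K _ _ t := by
  induction t using TensorProduct.induction_on with
  | zero => simp
  | tmul v w => rw [mulOneOne_tmul, W.coprod_one_one_cup A hA, TensorProduct.comm_tmul]
  | add t t' ht ht' => rw [map_add, map_add, ht, ht', map_add]; abel

/-- **`H²(A) = H¹(A) · H¹(A)`**: every degree-two class is `z = ½ mul(Δ_{1,1} z)`, a sum of
products of degree-one classes (cocommutativity makes `Δ_{1,1} z` antisymmetric, so
`z - ½ mul(Δ_{1,1} z)` is primitive, hence zero). [cite: MumfordAV1970, §1] -/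
theorem eq_half_mulOneOne_coprod (hA : IsSmoothProjective g A.X) (z : W.obj A.X 2) :
    z = (2 : K)⁻¹ • W.mulOneOne A (W.coprod A hA 1 1 rfl z) := by
  have hanti : TensorProduct.comm K _ _ (W.coprod A hA 1 1 rfl z) = -W.coprod A hA 1 1 rfl z := by
    have h := W.coprod_comm A hA (rfl : 1 + 1 = 2) rfl z
    simp only [Nat.cast_one, mul_one, Int.negOnePow_one, Units.val_neg, Units.val_one,
      neg_smul, one_smul] at h
    have h2 := congrArg (TensorProduct.comm K (W.obj A.X 1) (W.obj A.X 1)) h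
    rw [map_neg] at h2
    have hcc : ∀ t : W.obj A.X 1 ⊗[K] W.obj A.X 1, TensorProduct.comm K _ _
        (TensorProduct.comm K (W.obj A.X 1) (W.obj A.X 1) t) = t :=
      fun t ↦ (TensorProduct.comm K (W.obj A.X 1) (W.obj A.X 1)).apply_symm_apply t
    rw [hcc] at h2
    exact h2
  rw [← sub_eq_zero]
  apply W.eq_zero_of_coprod_one_one_eq_zero A hA
  rw [map_sub, map_smul, W.coprod_one_one_mulOneOne A hA, hanti, sub_neg_eq_add,
    ← two_smul K (W.coprod A hA 1 1 rfl z), smul_smul, inv_mul_cancel₀ two_ne_zero, one_smul,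
    sub_self]

/-- `H²(A)` is the image of `H¹(A) ⊗ H¹(A)` under the cup product. [cite: MumfordAV1970, §1] -/
theorem range_mulOneOne (hA : IsSmoothProjective g A.X) : LinearMap.range (W.mulOneOne A) = ⊤ := by
  rw [eq_top_iff]
  intro z _
  rw [W.eq_half_mulOneOne_coprod A hA z, ← map_smul]
  exact LinearMap.mem_range_self _ _

/-- **`[n]* = n²` on `H²(A)`**. [cite: MumfordAV1970, §15] -/
theorem pullback_pow_deg_two (hA : IsSmoothProjective g A.X) (n : ℕ) (z : W.obj A.X 2) :
    W.pullback ((𝟙 A.X) ^ n) 2 z = ((n : K) ^ 2) • z := by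
  rw [W.eq_half_mulOneOne_coprod A hA z, map_smul, ← smul_assoc, smul_eq_mul, mul_comm,
    ← smul_eq_mul, smul_assoc]
  congr 1
  generalize W.coprod A hA 1 1 rfl z = t
  induction t using TensorProduct.induction_on with
  | zero => simp
  | tmul v w =>
    rw [mulOneOne_tmul, W.pullback_pow_cup A hA n, W.pullback_pow_deg_one A hA,
      W.pullback_pow_deg_one A hA, LinearMap.map_smul₂, map_smul, smul_smul, ← sq]
  | add t t' ht ht' => rw [map_add, map_add, ht, ht', smul_add]

/-! ### Weights of powers and of the top degree -/

/-- `[n]* (wʳ) = ([n]* w)ʳ` for `w ∈ H²(A)`. [folklore] -/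
lemma pullback_pow_pow (hA : IsSmoothProjective g A.X) (n : ℕ) (w : W.obj A.X 2) (r : ℕ) :
    W.pullback ((𝟙 A.X) ^ n) (2 * r) (W.pow A.X w r) = W.pow A.X (W.pullback ((𝟙 A.X) ^ n) 2 w) r := by
  induction r with
  | zero => exact W.pullback_pow_unit A hA n
  | succ r ih => rw [W.pow_succ, W.pullback_pow_cup A hA, ih, ← W.pow_succ]

/-- `(c • w)ʳ = cʳ • wʳ`. [folklore] -/
lemma pow_smul_left {X : SchemeOver k} (w : W.obj X 2) (c : K) (r : ℕ) :
    W.pow X (c • w) r = c ^ r • W.pow X w r := by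
  induction r with
  | zero => simp
  | succ r ih =>
    rw [W.pow_succ, ih, W.pow_succ, LinearMap.map_smul₂, map_smul, smul_smul, pow_succ]

/-- **`[n]* = n^{2r}` on powers of degree-two classes**: `[n]* (wʳ) = n^{2r} wʳ`.
[cite: MumfordAV1970, §15] -/
theorem pullback_pow_pow_eq_smul (hA : IsSmoothProjective g A.X) (n : ℕ) (w : W.obj A.X 2)
    (r : ℕ) : W.pullback ((𝟙 A.X) ^ n) (2 * r) (W.pow A.X w r) = ((n : K) ^ (2 * r)) • W.pow A.X w r := by
  rw [W.pullback_pow_pow A hA, W.pullback_pow_deg_two A hA, W.pow_smul_left, ← pow_mul]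

/-- **`[n]* = n^{2g}` on the top degree `H²ᵍ(A)`**, given a degree-two class `w` with
`wᵍ ≠ 0` (e.g. a hyperplane class): `H²ᵍ(A) = K · wᵍ` is one-dimensional.
[cite: MumfordAV1970, §15] -/
theorem pullback_pow_top (hA : IsSmoothProjective g A.X) {w : W.obj A.X 2} (hw : W.pow A.X w g ≠ 0)
    (n : ℕ) (u : W.obj A.X (2 * g)) :
    W.pullback ((𝟙 A.X) ^ n) (2 * g) u = ((n : K) ^ (2 * g)) • u := by
  haveI := W.finite_obj hA (2 * g)
  obtain ⟨c, rfl⟩ := (finrank_eq_one_iff_of_nonzero' _ hw).mp (W.finrank_obj_two_mul hA) u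
  rw [map_smul, W.pullback_pow_pow_eq_smul A hA, smul_comm]

/-- The trace is scaled by `n^{2g}` under `[n]*`: `tr ([n]* u) = n^{2g} tr u`. [folklore] -/
theorem trace_pullback_pow (hA : IsSmoothProjective g A.X) {w : W.obj A.X 2} (hw : W.pow A.X w g ≠ 0)
    (n : ℕ) (u : W.obj A.X (2 * g)) :
    W.trace A.X g (W.pullback ((𝟙 A.X) ^ n) (2 * g) u) = ((n : K) ^ (2 * g)) * W.trace A.X g u := by
  rw [W.pullback_pow_top A hA hw, map_smul, smul_eq_mul]

end DegreeTwo

/-! ## Polynomiality of `n ↦ [n]*` and purity of weights -/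

section Weights

open Polynomial in
/-- **Linear independence of the monomial functions `n ↦ nʳ` on `ℕ`**, in the form used here:
if a finite `K`-linear combination of powers `Σ_s u_s n^{w s}` vanishes for every natural number
`n`, then for each exponent `R` the coefficients with `w s = R` sum to zero (a polynomial with
infinitely many roots is zero). [folklore] -/
lemma sum_filter_eq_zero_of_forall_nat {S : Type*} (s : Finset S) (u : S → K) (w : S → ℕ)
    (h : ∀ n : ℕ, ∑ x ∈ s, u x * (n : K) ^ (w x) = 0) (R : ℕ) :
    ∑ x ∈ s.filter (fun x ↦ w x = R), u x = 0 := by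
  classical
  let p : K[X] := ∑ x ∈ s, C (u x) * X ^ (w x)
  have hp : p = 0 := by
    apply Polynomial.eq_zero_of_infinite_isRoot
    refine Set.Infinite.mono (s := Set.range (fun n : ℕ ↦ (n : K))) ?_
      (Set.infinite_range_of_injective Nat.cast_injective)
    rintro _ ⟨n, rfl⟩
    simp only [Set.mem_setOf_eq, IsRoot.def, p, eval_finsetSum, eval_mul, eval_C, eval_pow, eval_X]
    exact h n
  have hc := congrArg (fun q : K[X] ↦ q.coeff R) hp
  simp only [p, finsetSum_coeff, coeff_C_mul_X_pow, coeff_zero] at hc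
  rw [Finset.sum_filter]
  simpa [eq_comm] using hc

/-- **Faulhaber** (existence form): for `e < d` there are constants `c₀, …, c_d ∈ K` with
`Σ_{m<n} mᵉ = Σ_{i≤d} cᵢ nⁱ` for all `n` (Mathlib's `sum_range_pow`, Bernoulli numbers).
[folklore] -/
lemma exists_sum_range_pow_eq (e d : ℕ) (hed : e < d) :
    ∃ c : ℕ → K, ∀ n : ℕ, (∑ m ∈ Finset.range n, (m : K) ^ e) =
      ∑ i ∈ Finset.range (d + 1), c i * (n : K) ^ i := by
  classical
  let coef : ℕ → K := fun j ↦ ((bernoulli j * ((e + 1).choose j : ℚ) / (e + 1) : ℚ) : K)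
  refine ⟨fun i ↦ ∑ j ∈ (Finset.range (e + 1)).filter (fun j ↦ e + 1 - j = i), coef j,
    fun n ↦ ?_⟩
  have h' : (∑ m ∈ Finset.range n, (m : K) ^ e) =
      ∑ j ∈ Finset.range (e + 1), coef j * (n : K) ^ (e + 1 - j) := by
    have h := congrArg (fun r : ℚ ↦ (r : K)) (sum_range_pow n e)
    simp only [Rat.cast_sum, Rat.cast_pow, Rat.cast_natCast] at h
    rw [h]
    refine Finset.sum_congr rfl fun j _ ↦ ?_
    simp only [coef]
    push_cast
    ring
  rw [h']
  symm
  calc ∑ i ∈ Finset.range (d + 1), (∑ j ∈ (Finset.range (e + 1)).filter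
          (fun j ↦ e + 1 - j = i), coef j) * (n : K) ^ i
      = ∑ i ∈ Finset.range (d + 1), ∑ j ∈ (Finset.range (e + 1)).filter
          (fun j ↦ e + 1 - j = i), coef j * (n : K) ^ (e + 1 - j) := by
        refine Finset.sum_congr rfl fun i _ ↦ ?_
        rw [Finset.sum_mul]
        refine Finset.sum_congr rfl fun j hj ↦ ?_
        rw [(Finset.mem_filter.mp hj).2]
    _ = ∑ j ∈ Finset.range (e + 1), coef j * (n : K) ^ (e + 1 - j) :=
        Finset.sum_fiberwise_of_maps_to (g := fun j ↦ e + 1 - j)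
          (fun j hj ↦ by simp only [Finset.mem_range] at hj ⊢; omega) _

open scoped MonObj

variable {g : ℕ} (A : AbelianVariety k)

/-- Convolution with a polynomial family of operators: if `[m]* = Σᵢ mⁱ Gᵢ` on `Hᵃ(A)` then
`[m]* s₍₁₎ ∪ s₍₂₎ = Σᵢ mⁱ (Gᵢ s₍₁₎ ∪ s₍₂₎)` for `s ∈ Hᵃ ⊗ Hᵇ`. [folklore] -/
lemma mulPullback_pow_eq_sum {a b d : ℕ} (h : a + b = d)
    {N : ℕ} (G : ℕ → (W.obj A.X a →ₗ[K] W.obj A.X a)) (m : ℕ)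
    (hG : W.pullback ((𝟙 A.X) ^ m) a = ∑ i ∈ Finset.range N, ((m : K) ^ i) • G i)
    (s : W.obj A.X a ⊗[K] W.obj A.X b) :
    W.mulPullback A ((𝟙 A.X) ^ m) (𝟙 A.X) h s =
      ∑ i ∈ Finset.range N, ((m : K) ^ i) •
        TensorProduct.lift ((W.cup h).compl₁₂ (G i) LinearMap.id) s := by
  induction s using TensorProduct.induction_on with
  | zero => simp
  | tmul x y =>
    rw [mulPullback_tmul, hG, W.pullback_id, LinearMap.sum_apply, LinearMap.map_sum₂]
    refine Finset.sum_congr rfl fun i _ ↦ ?_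
    rw [LinearMap.smul_apply, LinearMap.map_smul₂, TensorProduct.lift.tmul]
    rfl
  | add s s' hs hs' => rw [map_add, hs, hs', ← Finset.sum_add_distrib]; simp only [map_add, smul_add]

/-- **Polynomiality of `n ↦ [n]*`**: on `Hᵈ(A)` the operators `[n]*` are a polynomial in `n`
of degree `≤ d` with operator coefficients, `[n]* = Σ_{i≤d} nⁱ Fᵢ`, for all `n ∈ ℕ`
(from the convolution recursion by induction on the degree and Faulhaber's formula; this is
the Eulerian/Adams weight structure of the Hopf algebra `H•(A)`, Mumford §15 for the
classical theories). [cite: MumfordAV1970, §15] -/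
theorem exists_pullback_pow_eq_sum (hA : IsSmoothProjective g A.X) (d : ℕ) :
    ∃ F : ℕ → (W.obj A.X d →ₗ[K] W.obj A.X d), (∀ i, d < i → F i = 0) ∧
      ∀ n : ℕ, W.pullback ((𝟙 A.X) ^ n) d = ∑ i ∈ Finset.range (d + 1), ((n : K) ^ i) • F i := by
  classical
  induction d using Nat.strong_induction_on with
  | _ d IH =>
  rcases Nat.eq_zero_or_pos d with rfl | hd
  · refine ⟨fun i ↦ if i = 0 then LinearMap.id else 0, fun i hi ↦ if_neg (by omega), fun n ↦ ?_⟩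
    ext x
    simp [W.pullback_pow_deg_zero A hA]
  -- polynomial families in lower degrees, extended by zero
  choose F hF0 hF using IH
  let G : (a : ℕ) → ℕ → (W.obj A.X a →ₗ[K] W.obj A.X a) := fun a ↦
    if ha : a < d then F a ha else fun _ ↦ 0
  have hG : ∀ a, a < d → ∀ m : ℕ,
      W.pullback ((𝟙 A.X) ^ m) a = ∑ i ∈ Finset.range d, ((m : K) ^ i) • G a i := by
    intro a ha m
    simp only [G, dif_pos ha]
    rw [hF a ha m]
    refine Finset.sum_subset (Finset.range_subset_range.mpr (by omega)) ?_
    intro i _ hi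
    rw [hF0 a ha i (by simp at hi; omega), smul_zero]
  -- Faulhaber coefficients for every exponent `e < d`
  have hfaul : ∀ e : ℕ, ∃ c : ℕ → K, e < d → ∀ n : ℕ, (∑ m ∈ Finset.range n, (m : K) ^ e) =
      ∑ i ∈ Finset.range (d + 1), c i * (n : K) ^ i := by
    intro e
    by_cases he : e < d
    · obtain ⟨c, hc⟩ := exists_sum_range_pow_eq (K := K) e d he
      exact ⟨c, fun _ ↦ hc⟩
    · exact ⟨fun _ ↦ 0, fun h ↦ absurd h he⟩
  choose c hc using hfaul
  -- the operator attached to a middle bidegree `ij` and an exponent `e`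
  let Mid : Finset ↥(Finset.antidiagonal d) :=
    (Finset.univ : Finset ↥(Finset.antidiagonal d)).filter (fun ij ↦ ij.1.1 ≠ 0 ∧ ij.1.2 ≠ 0)
  let T : ↥(Finset.antidiagonal d) → ℕ → (W.obj A.X d →ₗ[K] W.obj A.X d) := fun ij e ↦
    TensorProduct.lift ((W.cup (Finset.mem_antidiagonal.mp ij.2)).compl₁₂ (G ij.1.1 e)
      LinearMap.id) ∘ₗ W.coprod A hA ij.1.1 ij.1.2 (Finset.mem_antidiagonal.mp ij.2)
  have hmid : ∀ (m : ℕ) (x : W.obj A.X d), W.middleSum A hA m x =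
      ∑ ij ∈ Mid, ∑ e ∈ Finset.range d, ((m : K) ^ e) • T ij e x := by
    intro m x
    refine Finset.sum_congr rfl fun ij hij ↦ ?_
    have h1 := Finset.mem_antidiagonal.mp ij.2
    have h2 := (Finset.mem_filter.mp hij).2
    rw [W.mulPullback_pow_eq_sum A _ (G ij.1.1) m (hG ij.1.1 (by omega) m)]
    rfl
  -- the new coefficients
  let Fd : ℕ → (W.obj A.X d →ₗ[K] W.obj A.X d) := fun i ↦
    if i ≤ d then (if i = 1 then LinearMap.id else 0) +
      ∑ ij ∈ Mid, ∑ e ∈ Finset.range d, c e i • T ij e else 0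
  refine ⟨Fd, fun i hi ↦ by simp only [Fd, if_neg (not_le.mpr hi)], fun n ↦ ?_⟩
  ext x
  -- telescope the recursion
  have htel : W.pullback ((𝟙 A.X) ^ n) d x =
      ∑ m ∈ Finset.range n, (x + W.middleSum A hA m x) := by
    rw [Finset.eq_sum_range_sub (fun m ↦ W.pullback ((𝟙 A.X) ^ m) d x) n,
      W.pullback_pow_zero_eq_zero A (by omega), zero_add]
    refine Finset.sum_congr rfl fun m _ ↦ ?_
    rw [W.pullback_pow_succ A hA m (by omega) x]
    abel
  rw [htel, Finset.sum_add_distrib, Finset.sum_const, Finset.card_range]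
  simp_rw [hmid]
  -- exchange the sums: `Σ_m Σ_ij Σ_e mᵉ T = Σ_ij Σ_e (Σ_m mᵉ) T = Σ_ij Σ_e Σ_i cₑᵢ nⁱ T`
  rw [Finset.sum_comm]
  have hinner : ∀ ij ∈ Mid, (∑ m ∈ Finset.range n, ∑ e ∈ Finset.range d, ((m : K) ^ e) • T ij e x)
      = ∑ i ∈ Finset.range (d + 1), ((n : K) ^ i) • ∑ e ∈ Finset.range d, c e i • T ij e x := by
    intro ij hij
    rw [Finset.sum_comm]
    simp_rw [← Finset.sum_smul]
    have : ∀ e ∈ Finset.range d, (∑ m ∈ Finset.range n, (m : K) ^ e) • T ij e x =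
        ∑ i ∈ Finset.range (d + 1), ((n : K) ^ i) • (c e i • T ij e x) := by
      intro e he
      rw [hc e (Finset.mem_range.mp he) n, Finset.sum_smul]
      refine Finset.sum_congr rfl fun i _ ↦ ?_
      rw [mul_comm, mul_smul]
    rw [Finset.sum_congr rfl this, Finset.sum_comm]
    refine Finset.sum_congr rfl fun i _ ↦ ?_
    rw [Finset.smul_sum]
  rw [Finset.sum_congr rfl hinner, Finset.sum_comm]
  -- right-hand side
  rw [LinearMap.sum_apply]
  have hrhs : ∀ i ∈ Finset.range (d + 1), (((n : K) ^ i) • Fd i) x =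
      ((n : K) ^ i) • (if i = 1 then x else 0) +
        ((n : K) ^ i) • ∑ ij ∈ Mid, ∑ e ∈ Finset.range d, c e i • T ij e x := by
    intro i hi
    have hi' : i ≤ d := by simp at hi; omega
    simp only [Fd, if_pos hi', LinearMap.smul_apply, LinearMap.add_apply, smul_add,
      LinearMap.sum_apply]
    congr 1
    split_ifs <;> simp
  rw [Finset.sum_congr rfl hrhs, Finset.sum_add_distrib]
  congr 1
  · symm
    simp_rw [smul_ite, smul_zero]
    rw [Finset.sum_ite_eq', if_pos (Finset.mem_range.mpr (by omega)), pow_one]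
    exact Nat.cast_smul_eq_nsmul K n x
  · refine Finset.sum_congr rfl fun i _ ↦ ?_
    rw [Finset.smul_sum]

/-- **Purity of weights: `[n]* = nᵈ` on `Hᵈ(A)`** for every `n ∈ ℕ` and every degree `d`,
given a degree-two class `w` with `wᵍ ≠ 0` (a hyperplane class). Proof: write `[n]* = Σᵢ nⁱ Fᵢ`
on `Hᵈ` and `[n]* = Σⱼ nʲ F'ⱼ` on `H²ᵍ⁻ᵈ` (polynomiality); multiplicativity of `[n]*`,
`[n]* = n^{2g}` on `H²ᵍ` and `[na]* = [n]* [a]*` give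
`Σᵢⱼ (na)ⁱ nʲ tr(Fᵢ x ∪ F'ⱼ y) = n^{2g} tr([a]* x ∪ y)` for all `n`; comparing the coefficients of
`n^{2g}` (`i + j = 2g` forces `i = d`, `j = 2g - d`) at `a` and at `a = 1` yields
`tr([a]* x ∪ y) = aᵈ tr(x ∪ y)` for all `y`, whence the claim by Poincaré duality
(Kleiman 1968, 2A; Mumford §15 / Milne, *Abelian Varieties* 12.1 for the classical theories:
`n_A* = nⁱ` on `Hⁱ`). [cite: Kleiman1968AlgebraicCycles, Appendix 2A] -/
theorem pullback_pow_eq_pow_smul (hA : IsSmoothProjective g A.X) {w : W.obj A.X 2}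
    (hw : W.pow A.X w g ≠ 0) (d a : ℕ) (x : W.obj A.X d) :
    W.pullback ((𝟙 A.X) ^ a) d x = ((a : K) ^ d) • x := by
  classical
  by_cases hdg : 2 * g < d
  · rw [W.eq_zero_of_lt hA hdg x, map_zero, smul_zero]
  obtain ⟨j, hj⟩ : ∃ j, d + j = 2 * g := ⟨2 * g - d, by omega⟩
  obtain ⟨F, -, hF⟩ := W.exists_pullback_pow_eq_sum A hA d
  obtain ⟨F', -, hF'⟩ := W.exists_pullback_pow_eq_sum A hA j
  -- the coefficient identity, for every `a'` and `y`
  have key : ∀ (a' : ℕ) (y : W.obj A.X j),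
      W.trace A.X g (W.cup hj (W.pullback ((𝟙 A.X) ^ a') d x) y) =
        ((a' : K) ^ d) * W.trace A.X g (W.cup hj (F d x) (F' j y)) := by
    intro a' y
    let cc : ℕ × ℕ → K := fun ij ↦ W.trace A.X g (W.cup hj (F ij.1 x) (F' ij.2 y))
    let V : K := W.trace A.X g (W.cup hj (W.pullback ((𝟙 A.X) ^ a') d x) y)
    -- `Σ_{ij} (a'ⁱ c_{ij} - [ij = (d,j)] V) n^{i+j} = 0` for all `n`
    have hsum : ∀ n : ℕ, ∑ ij ∈ Finset.range (d + 1) ×ˢ Finset.range (j + 1),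
        (((a' : K) ^ ij.1) * cc ij - if ij = (d, j) then V else 0) * (n : K) ^ (ij.1 + ij.2) = 0 := by
      intro n
      -- left: `tr([n a']* x ∪ [n]* y)` expanded
      have hL : W.trace A.X g (W.cup hj (W.pullback ((𝟙 A.X) ^ (n * a')) d x)
          (W.pullback ((𝟙 A.X) ^ n) j y)) =
          ∑ ij ∈ Finset.range (d + 1) ×ˢ Finset.range (j + 1),
            ((a' : K) ^ ij.1 * cc ij) * (n : K) ^ (ij.1 + ij.2) := by
        rw [hF, hF', LinearMap.sum_apply, LinearMap.sum_apply, LinearMap.map_sum₂, map_sum,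
          Finset.sum_product]
        refine Finset.sum_congr rfl fun i _ ↦ ?_
        rw [map_sum, map_sum]
        refine Finset.sum_congr rfl fun i' _ ↦ ?_
        simp only [LinearMap.smul_apply, map_smul, smul_eq_mul, cc]
        push_cast
        ring
      -- right: `tr([n]* ([a']* x ∪ y)) = n^{2g} tr([a']* x ∪ y)`
      have hR : W.trace A.X g (W.cup hj (W.pullback ((𝟙 A.X) ^ (n * a')) d x)
          (W.pullback ((𝟙 A.X) ^ n) j y)) = (n : K) ^ (2 * g) * V := by
        rw [W.pullback_pow_mul A, LinearMap.comp_apply, ← W.pullback_pow_cup A hA,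
          W.trace_pullback_pow A hA hw]
      have hV : ∑ ij ∈ Finset.range (d + 1) ×ˢ Finset.range (j + 1),
          (if ij = (d, j) then V else 0) * (n : K) ^ (ij.1 + ij.2) = (n : K) ^ (2 * g) * V := by
        rw [Finset.sum_eq_single_of_mem (d, j) (by simp)]
        · simp [hj, mul_comm]
        · intro ij _ hij
          rw [if_neg hij, zero_mul]
      simp_rw [sub_mul]
      rw [Finset.sum_sub_distrib, ← hL, hR, hV, sub_self]
    have hc := sum_filter_eq_zero_of_forall_nat (K := K) _ _ (fun ij : ℕ × ℕ ↦ ij.1 + ij.2) hsum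
      (2 * g)
    -- the only index with `i + j = 2g` is `(d, j)`
    have hfil : (Finset.range (d + 1) ×ˢ Finset.range (j + 1)).filter
        (fun ij : ℕ × ℕ ↦ ij.1 + ij.2 = 2 * g) = {(d, j)} := by
      ext ⟨i, i'⟩
      simp only [Finset.mem_filter, Finset.mem_product, Finset.mem_range, Finset.mem_singleton,
        Prod.mk.injEq]
      omega
    rw [hfil, Finset.sum_singleton, if_pos rfl, sub_eq_zero] at hc
    exact hc.symm
  -- compare `a` with `a = 1`
  have key' : ∀ y : W.obj A.X j, W.trace A.X g (W.cup hj (W.pullback ((𝟙 A.X) ^ a) d x) y) =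
      W.trace A.X g (W.cup hj (((a : K) ^ d) • x) y) := by
    intro y
    have h1 := key 1 y
    rw [pow_one, W.pullback_id, LinearMap.id_apply, Nat.cast_one, one_pow, one_mul] at h1
    rw [key a y, ← h1, LinearMap.map_smul₂, map_smul, smul_eq_mul]
  -- Poincaré duality
  haveI := W.isPerfPair_cupPairing hA d j hj
  have hinj := (LinearMap.IsPerfPair.bijective_left (W.cupPairing A.X g d j hj)).1
  apply hinj
  ext y
  simp only [cupPairing_apply]
  exact key' y

/-! ### Generation of `H•(A)` by `H¹(A)` -/

/-- The cup product `H¹(A) ⊗ Hᵉ(A) → Hᵉ⁺¹(A)` on tensors. [folklore] -/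
def mulOne (e : ℕ) : W.obj A.X 1 ⊗[K] W.obj A.X e →ₗ[K] W.obj A.X (e + 1) :=
  TensorProduct.lift (W.cup (Nat.add_comm 1 e))

/-- `mulOne` on an elementary tensor is the cup product `v ∪ y`. [folklore] -/
@[simp]
lemma mulOne_tmul (e : ℕ) (v : W.obj A.X 1) (y : W.obj A.X e) :
    W.mulOne A e (v ⊗ₜ y) = W.cup (Nat.add_comm 1 e) v y := by
  simp [mulOne]

/-- **`H•(A)` is generated by `H¹(A)`**: the cup product `H¹(A) ⊗ Hᵉ(A) → Hᵉ⁺¹(A)` is onto for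
every `e` (given a degree-two class `w` with `wᵍ ≠ 0`). From purity: for `x ∈ Hᵈ(A)`, `d ≥ 2`,
the convolution recursion at `n = 1` reads `(2ᵈ - 2) x = Σ_{a,b ≥ 1} x₍ₐ₎ ∪ x₍ᵦ₎`, a sum of
products of classes of lower positive degree; induct on the degree (Kleiman 1968, 2A:
`H•(A) = Λ• H¹(A)`; Mumford §15). [cite: Kleiman1968AlgebraicCycles, Appendix 2A] -/
theorem range_mulOne (hA : IsSmoothProjective g A.X) {w : W.obj A.X 2} (hw : W.pow A.X w g ≠ 0)
    (e : ℕ) : LinearMap.range (W.mulOne A e) = ⊤ := by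
  classical
  induction e using Nat.strong_induction_on with
  | _ e IH =>
  rw [eq_top_iff]
  rintro x -
  rcases Nat.eq_zero_or_pos e with rfl | he
  · -- degree one: `x = x ∪ 1`... rather `x = 1' ∪ x'`: use `H¹ ⊗ H⁰ ∋ x ⊗ 1 ↦ x ∪ 1 = x`
    refine ⟨x ⊗ₜ W.one A.X, ?_⟩
    rw [mulOne_tmul, W.cup_one hA]
  -- products of two classes of positive degrees `a + b = e + 1` lie in the range
  have hprod : ∀ (a b : ℕ) (hab : a + b = e + 1) (ha : a ≠ 0) (hb : b ≠ 0)
      (t : W.obj A.X a ⊗[K] W.obj A.X b),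
      TensorProduct.lift (W.cup hab) t ∈ LinearMap.range (W.mulOne A e) := by
    intro a b hab ha hb t
    obtain ⟨a', rfl⟩ : ∃ a', a = a' + 1 := ⟨a - 1, by omega⟩
    have IH' := IH a' (by omega)
    induction t using TensorProduct.induction_on with
    | zero => rw [map_zero]; exact zero_mem _
    | tmul p q =>
      have hp : p ∈ LinearMap.range (W.mulOne A a') := by rw [IH']; trivial
      obtain ⟨t₀, rfl⟩ := hp
      induction t₀ using TensorProduct.induction_on with
      | zero => rw [map_zero, TensorProduct.lift.tmul, LinearMap.map_zero₂]; exact zero_mem _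
      | tmul v y =>
        refine ⟨v ⊗ₜ W.cup (show a' + b = e by omega) y q, ?_⟩
        rw [TensorProduct.lift.tmul, mulOne_tmul, mulOne_tmul,
          W.cup_assoc hA (Nat.add_comm 1 a') (show a' + b = e by omega) hab (Nat.add_comm 1 e)]
      | add t t' ht ht' =>
        rw [map_add, TensorProduct.lift.tmul, LinearMap.map_add₂]
        rw [TensorProduct.lift.tmul] at ht ht'
        exact add_mem ht ht'
    | add t t' ht ht' => rw [map_add]; exact add_mem ht ht'
  -- the recursion at `n = 1`: `2^(e+1) x = x + x + middleSum 1 x`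
  have hrec := W.pullback_pow_succ A hA 1 (Nat.succ_ne_zero e) x
  rw [W.pullback_pow_eq_pow_smul A hA hw, pow_one, W.pullback_id, LinearMap.id_apply] at hrec
  have hmid : W.middleSum A hA 1 x ∈ LinearMap.range (W.mulOne A e) := by
    refine sum_mem fun ij hij ↦ ?_
    have h2 := (Finset.mem_filter.mp hij).2
    have hmp : W.mulPullback A ((𝟙 A.X) ^ 1) (𝟙 A.X) (Finset.mem_antidiagonal.mp ij.2) =
        TensorProduct.lift (W.cup (Finset.mem_antidiagonal.mp ij.2)) := by
      ext p q
      simp [mulPullback, W.pullback_id]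
    rw [hmp]
    exact hprod _ _ _ h2.1 h2.2 _
  have hx : x = (((2 : ℕ) : K) ^ (e + 1) - 2)⁻¹ • W.middleSum A hA 1 x := by
    have h2 : (((2 : ℕ) : K) ^ (e + 1) - 2) • x = W.middleSum A hA 1 x := by
      rw [sub_smul, hrec, two_smul]; abel
    have hne : ((2 : ℕ) : K) ^ (e + 1) - 2 ≠ 0 := by
      rw [sub_ne_zero]
      norm_cast
      have : 2 ^ 2 ≤ 2 ^ (e + 1) := Nat.pow_le_pow_right (by norm_num) (by omega)
      omega
    rw [← h2, smul_smul, inv_mul_cancel₀ hne, one_smul]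
  rw [hx]
  exact Submodule.smul_mem _ _ hmid

end Weights

end WeilCohomology

end Literature.AlgebraicGeometry.Motives

end
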